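import Summits.ValiantsHypothesis.ValiantsHypothesis.Theses.RigidityForcesSymmetry
import Literature.Computability.AlgebraicComplexity.DetReprEquivalent
import Literature.Computability.AlgebraicComplexity.LRLiftCharacter

/-!
# Route RigidityForcesSymmetry — `RigidityForcesTorus` (item stmt-ValiantsHypothesis-4166)

A locally rigid affine determinantal representation `Ã = Λ + Σ_v x_v A_v` of `per_n` (its
`GL_m × GL_m`-orbit is open near `(Λ, A)` in coefficient space, in the sense of
`RigidMinimalRepr`) respects the two-sided torus `x_{kl} ↦ d_k e_l x_{kl}` with exact lifts
(`IsEquivariantDetRepr` for the subgroup generated by the diagonal substitutions `diag(d_k e_l)`).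

Proof (elementary open-subgroup argument, Landsberg–Ressayre 2017 §2.1 for the torus of `G_per`,
Borel 1991-type connectedness replaced by an additive-subgroup argument along `exp`):
for `(a, b) ∈ ℂⁿ × ℂⁿ` put `γ(a,b) = diag(exp(a_k + b_l))`, `τ = exp(-(Σ a + Σ b))` and
`D = diag(τ, 1, …, 1)`.  The coefficient point `F(a,b) = (D Λ, v ↦ exp(a_{v₁} + b_{v₂}) D A_v)` depends
continuously on `(a, b)`, equals `(Λ, A)` at `0`, and its pencil is `D · Ã(γ(a,b)·x)` whose determinant
is `τ · (Π exp a · Π exp b) · per_n = per_n` (the torus rescales `per_n` by its character,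
`LRPencil.linSubst_diagonal_perPoly`).  Rigidity gives `(g, h)` with `F(a,b) = (gΛh⁻¹, gA_vh⁻¹)` for
`(a,b)` near `0`, whence `Ã(γ(a,b)·x) = (D⁻¹ g) Ã h⁻¹`: all `γ(a,b)` with `(a,b)` near `0` lift.  Lifts
compose and invert, so the set of liftable parameters `(a,b)` is an additive subgroup of `ℂ²ⁿ`
containing a neighbourhood of `0`, hence all of `ℂ²ⁿ` (`x = N • (x/N)`); every generator
`diag(d_k e_l) ∈ GL` has `d, e` nowhere zero (`n ≥ 1`), so it is `γ(log d, log e)`; finally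
`Subgroup.closure_induction`.
-/

noncomputable section

-- `Summit.ValiantsHypothesis.ValiantsHypothesis.…` is the tree's mandated single-conjunct layout (Sub = Summit).
set_option linter.dupNamespace false

namespace Summit.ValiantsHypothesis.ValiantsHypothesis.Theorems

open MvPolynomial Matrix Filter Topology
open scoped Kronecker
open Literature.Computability.AlgebraicComplexity
open Summit.ValiantsHypothesis.ValiantsHypothesis.Theses.RigidityForcesSymmetry

section Pencil

variable {σ : Type*} [Fintype σ] [DecidableEq σ] {ι : Type*} [Fintype ι] [DecidableEq ι]

omit [DecidableEq σ] [Fintype ι] [DecidableEq ι] in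
/-- The entries of an affine pencil `Λ + Σ_v x_v A_v` are affine (total degree `≤ 1`). [folklore] -/
theorem rft_totalDegree_pencil_le (Λ : Matrix ι ι ℂ) (A : σ → Matrix ι ι ℂ) (i j : ι) :
    ((Λ.map C + ∑ v, (X v : MvPolynomial σ ℂ) • (A v).map C : Matrix ι ι (MvPolynomial σ ℂ))
      i j).totalDegree ≤ 1 := by
  simp only [Matrix.add_apply, Matrix.sum_apply, Matrix.smul_apply, Matrix.map_apply, smul_eq_mul]
  refine (totalDegree_add _ _).trans (max_le ?_ ?_)
  · rw [totalDegree_C]; exact Nat.zero_le _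
  · refine totalDegree_finsetSum_le fun v _ => (totalDegree_mul _ _).trans ?_
    rw [totalDegree_C, add_zero]
    exact (totalDegree_X (R := ℂ) v).le

omit [DecidableEq σ] [DecidableEq ι] in
/-- Constant two-sided multiplication acts on the coefficients of a pencil:
`P (Λ + Σ x_v A_v) Q = PΛQ + Σ x_v (P A_v Q)`. [folklore] -/
theorem rft_map_C_mul_pencil_mul_map_C (P Q Λ : Matrix ι ι ℂ) (A : σ → Matrix ι ι ℂ) :
    (P.map C : Matrix ι ι (MvPolynomial σ ℂ)) *
        (Λ.map C + ∑ v, (X v : MvPolynomial σ ℂ) • (A v).map C) * Q.map C =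
      (P * Λ * Q).map C + ∑ v, (X v : MvPolynomial σ ℂ) • (P * A v * Q).map C := by
  simp only [Matrix.mul_add, Matrix.add_mul, Finset.mul_sum, Finset.sum_mul, Matrix.mul_smul,
    Matrix.smul_mul, Matrix.map_mul]

omit [DecidableEq σ] [DecidableEq ι] in
/-- Constant left multiplication acts on the coefficients of a pencil. [folklore] -/
theorem rft_map_C_mul_pencil (P Λ : Matrix ι ι ℂ) (A : σ → Matrix ι ι ℂ) :
    (P.map C : Matrix ι ι (MvPolynomial σ ℂ)) *
        (Λ.map C + ∑ v, (X v : MvPolynomial σ ℂ) • (A v).map C) =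
      (P * Λ).map C + ∑ v, (X v : MvPolynomial σ ℂ) • (P * A v).map C := by
  simp only [Matrix.mul_add, Finset.mul_sum, Matrix.mul_smul, Matrix.map_mul]

/-- A diagonal substitution rescales each variable: `diag(c) · x_v = c_v x_v`. [folklore] -/
theorem rft_linSubst_diagonal_X (c : σ → ℂ) (v : σ) :
    linSubst σ ℂ (Matrix.diagonal c) (X v) = c v • X v := by
  rw [linSubst_X, Finset.sum_eq_single v]
  · rw [Matrix.diagonal_apply_eq]
  · intro w _ hw
    rw [Matrix.diagonal_apply_ne _ hw, zero_smul]
  · intro hv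
    exact absurd (Finset.mem_univ v) hv

omit [Fintype ι] [DecidableEq ι] in
/-- A diagonal substitution `x_v ↦ c_v x_v` acts on a pencil by rescaling its coefficient
matrices: `(Λ + Σ x_v A_v)(γ·x) = Λ + Σ x_v (c_v A_v)`. [folklore] -/
theorem rft_linSubstEntries_pencil {γ : GL σ ℂ} {c : σ → ℂ}
    (hγ : (γ : Matrix σ σ ℂ) = Matrix.diagonal c) (Λ : Matrix ι ι ℂ) (A : σ → Matrix ι ι ℂ) :
    Matrix.linSubstEntries γ (Λ.map C + ∑ v, (X v : MvPolynomial σ ℂ) • (A v).map C) =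
      Λ.map C + ∑ v, (X v : MvPolynomial σ ℂ) • (c v • A v).map C := by
  refine Matrix.ext fun i j => ?_
  rw [Matrix.linSubstEntries_apply, hγ]
  simp only [Matrix.add_apply, Matrix.sum_apply, Matrix.smul_apply, Matrix.map_apply, smul_eq_mul]
  rw [map_add, linSubst_C, map_sum (linSubst σ ℂ (Matrix.diagonal c))]
  refine congrArg (C (Λ i j) + ·) (Finset.sum_congr rfl fun v _ => ?_)
  rw [map_mul, linSubst_C, rft_linSubst_diagonal_X, smul_eq_C_mul, C_mul]
  ring

/-- Lifts compose: if `γ` and `δ` lift to `GL × GL` on `M`, so does `γδ`. [folklore] -/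
theorem rft_lift_mul {M : Matrix ι ι (MvPolynomial σ ℂ)} {γ δ : GL σ ℂ}
    (hγ : ∃ g h : GL ι ℂ, Matrix.linSubstEntries γ M =
      (g : Matrix ι ι ℂ).map C * M * ((h⁻¹ : GL ι ℂ) : Matrix ι ι ℂ).map C)
    (hδ : ∃ g h : GL ι ℂ, Matrix.linSubstEntries δ M =
      (g : Matrix ι ι ℂ).map C * M * ((h⁻¹ : GL ι ℂ) : Matrix ι ι ℂ).map C) :
    ∃ g h : GL ι ℂ, Matrix.linSubstEntries (γ * δ) M =
      (g : Matrix ι ι ℂ).map C * M * ((h⁻¹ : GL ι ℂ) : Matrix ι ι ℂ).map C := by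
  obtain ⟨g₁, h₁, e₁⟩ := hγ
  obtain ⟨g₂, h₂, e₂⟩ := hδ
  refine ⟨g₂ * g₁, h₂ * h₁, ?_⟩
  rw [← Matrix.linSubstEntries_linSubstEntries, e₂, Matrix.linSubstEntries_mul,
    Matrix.linSubstEntries_mul, Matrix.linSubstEntries_map_C, Matrix.linSubstEntries_map_C, e₁]
  simp only [_root_.mul_inv_rev, Units.val_mul, Matrix.map_mul, Matrix.mul_assoc]

/-- Lifts invert: if `γ` lifts to `GL × GL` on `M`, so does `γ⁻¹`. [folklore] -/
theorem rft_lift_inv {M : Matrix ι ι (MvPolynomial σ ℂ)} {γ : GL σ ℂ}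
    (hγ : ∃ g h : GL ι ℂ, Matrix.linSubstEntries γ M =
      (g : Matrix ι ι ℂ).map C * M * ((h⁻¹ : GL ι ℂ) : Matrix ι ι ℂ).map C) :
    ∃ g h : GL ι ℂ, Matrix.linSubstEntries γ⁻¹ M =
      (g : Matrix ι ι ℂ).map C * M * ((h⁻¹ : GL ι ℂ) : Matrix ι ι ℂ).map C := by
  obtain ⟨g, h, e⟩ := hγ
  refine ⟨g⁻¹, h⁻¹, ?_⟩
  have e' := congrArg (Matrix.linSubstEntries γ⁻¹) e
  rw [Matrix.linSubstEntries_inv_linSubstEntries, Matrix.linSubstEntries_mul,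
    Matrix.linSubstEntries_mul, Matrix.linSubstEntries_map_C, Matrix.linSubstEntries_map_C] at e'
  calc Matrix.linSubstEntries γ⁻¹ M
      = ((g⁻¹ : GL ι ℂ) : Matrix ι ι ℂ).map C *
          ((g : Matrix ι ι ℂ).map C * Matrix.linSubstEntries γ⁻¹ M *
            ((h⁻¹ : GL ι ℂ) : Matrix ι ι ℂ).map C) *
          (((h⁻¹)⁻¹ : GL ι ℂ) : Matrix ι ι ℂ).map C :=
        (inv_map_C_mul_mul_map_C_inv g h⁻¹ _).symm
    _ = _ := by rw [← e']

/-- From a gauge pair for the rescaled point to a lift: if `D Λ = g Λ h⁻¹` and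
`c_v D A_v = g A_v h⁻¹` then `Ã(diag(c)·x) = (D⁻¹ g) Ã h⁻¹`. [folklore] -/
theorem rft_lift_of_gauge {γ : GL σ ℂ} {c : σ → ℂ} (hγ : (γ : Matrix σ σ ℂ) = Matrix.diagonal c)
    (Λ : Matrix ι ι ℂ) (A : σ → Matrix ι ι ℂ) (D g h : GL ι ℂ)
    (h1 : (D : Matrix ι ι ℂ) * Λ = (g : Matrix ι ι ℂ) * Λ * ((h⁻¹ : GL ι ℂ) : Matrix ι ι ℂ))
    (h2 : ∀ v, c v • ((D : Matrix ι ι ℂ) * A v) =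
      (g : Matrix ι ι ℂ) * A v * ((h⁻¹ : GL ι ℂ) : Matrix ι ι ℂ)) :
    ∃ g' h' : GL ι ℂ, Matrix.linSubstEntries γ (Λ.map C + ∑ v, (X v : MvPolynomial σ ℂ) • (A v).map C) =
      (g' : Matrix ι ι ℂ).map C * (Λ.map C + ∑ v, (X v : MvPolynomial σ ℂ) • (A v).map C) *
        ((h'⁻¹ : GL ι ℂ) : Matrix ι ι ℂ).map C := by
  refine ⟨D⁻¹ * g, h, ?_⟩
  rw [rft_linSubstEntries_pencil hγ, rft_map_C_mul_pencil_mul_map_C]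
  have e1 : ((D⁻¹ * g : GL ι ℂ) : Matrix ι ι ℂ) * Λ * ((h⁻¹ : GL ι ℂ) : Matrix ι ι ℂ) = Λ := by
    rw [Units.val_mul, Matrix.mul_assoc, Matrix.mul_assoc, ← Matrix.mul_assoc (g : Matrix ι ι ℂ),
      ← h1, Units.inv_mul_cancel_left]
  have e2 : ∀ v, ((D⁻¹ * g : GL ι ℂ) : Matrix ι ι ℂ) * A v * ((h⁻¹ : GL ι ℂ) : Matrix ι ι ℂ) =
      c v • A v := by
    intro v
    rw [Units.val_mul, Matrix.mul_assoc, Matrix.mul_assoc, ← Matrix.mul_assoc (g : Matrix ι ι ℂ),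
      ← h2 v, Matrix.mul_smul, Units.inv_mul_cancel_left]
  rw [e1]
  simp_rw [e2]

/-- A diagonal matrix with nowhere-zero entries is (the matrix of) an element of `GL`. [folklore] -/
theorem rft_exists_GL_eq_diagonal (c : ι → ℂ) (hc : ∀ i, c i ≠ 0) :
    ∃ γ : GL ι ℂ, (γ : Matrix ι ι ℂ) = Matrix.diagonal c :=
  ⟨⟨Matrix.diagonal c, Matrix.diagonal fun i => (c i)⁻¹,
    by simp [Matrix.diagonal_mul_diagonal, hc],
    by simp [Matrix.diagonal_mul_diagonal, hc]⟩, rfl⟩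

end Pencil

/-- `per_n ≠ 1` for `n ≥ 1` (it is homogeneous of degree `n`), so a `0 × 0` matrix does not
represent it: any affine determinantal representation of `per_n` has positive size. [folklore] -/
theorem rft_perPoly_ne_one {n : ℕ} (hn : 1 ≤ n) : perPoly (Fin n) ℂ ≠ 1 := by
  intro h
  have h1 : (1 : MvPolynomial (Fin n × Fin n) ℂ).IsHomogeneous (Fintype.card (Fin n)) := by
    rw [← h]; exact perPoly_isHomogeneous
  have h0 : (1 : MvPolynomial (Fin n × Fin n) ℂ).IsHomogeneous 0 := isHomogeneous_one _ _
  have := h1.inj_right h0 one_ne_zero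
  rw [Fintype.card_fin] at this
  omega

/-- **`RigidityForcesTorus`** (item stmt-ValiantsHypothesis-4166 of route RigidityForcesSymmetry): an
affine determinantal representation `Λ + Σ x_v A_v` of `per_n`, `n ≥ 3`, whose `GL_m × GL_m`-orbit is
locally open in `{det = per_n}` (as in `RigidMinimalRepr`) is equivariant with exact lifts for the
two-sided torus `x_{kl} ↦ d_k e_l x_{kl}`. [folklore] -/
theorem rigidityForcesTorus_proof : RigidityForcesTorus := by
  intro n hn m Λ A hdet hU
  refine ⟨⟨fun i j => rft_totalDegree_pencil_le Λ A i j, hdet⟩, ?_⟩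
  obtain ⟨U, hUmem, hU⟩ := hU
  -- `m ≠ 0`: a `0 × 0` matrix has determinant `1 ≠ per_n`
  have hm : 0 < m := by
    rcases Nat.eq_zero_or_pos m with rfl | h
    · exfalso
      refine rft_perPoly_ne_one (by omega : 1 ≤ n) ?_
      rw [← hdet, Matrix.det_isEmpty]
    · exact h
  set i₀ : Fin m := ⟨0, hm⟩ with hi₀
  -- the correcting diagonal gauge `D t = diag(t, 1, …, 1)`
  obtain ⟨D, hD⟩ : ∃ D : ℂ → Matrix (Fin m) (Fin m) ℂ,
      D = fun t => Matrix.diagonal fun i => if i = i₀ then t else 1 := ⟨_, rfl⟩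
  have hDc : Continuous D := by
    rw [hD]
    refine Continuous.matrix_diagonal (continuous_pi fun i => ?_)
    by_cases h : i = i₀
    · simp only [h, if_true]; exact continuous_id
    · simp only [h, if_false]; exact continuous_const
  have hDdet : ∀ t, (D t).det = t := by
    intro t
    simp [hD, Matrix.det_diagonal, Finset.prod_ite_eq']
  have hD1 : D 1 = 1 := by simp [hD]
  have hDne : ∀ t, t ≠ 0 → ∀ i, (fun i => if i = i₀ then t else (1 : ℂ)) i ≠ 0 := by
    intro t ht i
    by_cases h : i = i₀ <;> simp [h, ht]
  -- notation: the pencil, lifts, the torus parametrisation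
  set M : Matrix (Fin m) (Fin m) (MvPolynomial (Fin n × Fin n) ℂ) :=
    Λ.map C + ∑ v, (X v : MvPolynomial (Fin n × Fin n) ℂ) • (A v).map C with hM
  obtain ⟨Lift, hLift⟩ : ∃ Lift : GL (Fin n × Fin n) ℂ → Prop, Lift = fun γ =>
      ∃ g h : GL (Fin m) ℂ, Matrix.linSubstEntries γ M =
        (g : Matrix (Fin m) (Fin m) ℂ).map C * M * ((h⁻¹ : GL (Fin m) ℂ) : Matrix (Fin m) (Fin m) ℂ).map C :=
    ⟨_, rfl⟩
  obtain ⟨tor, htor⟩ : ∃ tor : (Fin n → ℂ) × (Fin n → ℂ) → (Fin n × Fin n → ℂ),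
      tor = fun x p => Complex.exp (x.1 p.1 + x.2 p.2) := ⟨_, rfl⟩
  obtain ⟨P, hP⟩ : ∃ P : (Fin n → ℂ) × (Fin n → ℂ) → Prop, P = fun x =>
      ∀ γ : GL (Fin n × Fin n) ℂ, (γ : Matrix (Fin n × Fin n) (Fin n × Fin n) ℂ) =
        Matrix.diagonal (tor x) → Lift γ := ⟨_, rfl⟩
  have htor_ne : ∀ x p, tor x p ≠ 0 := by
    intro x p; rw [htor]; exact Complex.exp_ne_zero _
  have htor_add : ∀ x y, tor (x + y) = fun p => tor x p * tor y p := by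
    intro x y; funext p
    simp only [htor, Prod.fst_add, Prod.snd_add, Pi.add_apply, ← Complex.exp_add]
    ring_nf
  -- (S2) liftable parameters are closed under addition
  have hP_add : ∀ x y, P x → P y → P (x + y) := by
    intro x y hx hy
    rw [hP] at hx hy ⊢
    intro γ hγ
    obtain ⟨γx, hγx⟩ := rft_exists_GL_eq_diagonal (tor x) (htor_ne x)
    obtain ⟨γy, hγy⟩ := rft_exists_GL_eq_diagonal (tor y) (htor_ne y)
    have hmul : γ = γx * γy := by
      refine Units.ext ?_
      rw [Units.val_mul, hγ, hγx, hγy, Matrix.diagonal_mul_diagonal, htor_add]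
    rw [hmul, hLift]
    have h1 := hx γx hγx
    have h2 := hy γy hγy
    rw [hLift] at h1 h2
    exact rft_lift_mul h1 h2
  -- (S1) liftable parameters contain a neighbourhood of `0`
  have hP_nhds : {x | P x} ∈ 𝓝 (0 : (Fin n → ℂ) × (Fin n → ℂ)) := by
    -- the continuous family of coefficient points
    obtain ⟨τ, hτ⟩ : ∃ τ : (Fin n → ℂ) × (Fin n → ℂ) → ℂ,
        τ = fun x => Complex.exp (-(∑ k, x.1 k + ∑ l, x.2 l)) := ⟨_, rfl⟩
    obtain ⟨F, hF⟩ : ∃ F : (Fin n → ℂ) × (Fin n → ℂ) →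
        Matrix (Fin m) (Fin m) ℂ × (Fin n × Fin n → Matrix (Fin m) (Fin m) ℂ),
        F = fun x => (D (τ x) * Λ, fun v => tor x v • (D (τ x) * A v)) := ⟨_, rfl⟩
    have hFc : Continuous F := by
      rw [hF, hτ, htor]
      fun_prop
    have hF0 : F 0 = (Λ, A) := by
      simp [hF, hτ, htor, hD1]
    have hFU : F ⁻¹' U ∈ 𝓝 (0 : (Fin n → ℂ) × (Fin n → ℂ)) :=
      hFc.continuousAt.preimage_mem_nhds (by rw [hF0]; exact hUmem)
    refine Filter.mem_of_superset hFU fun x hx => ?_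
    simp only [Set.mem_setOf_eq, hP]
    intro γ hγ
    -- determinant of the pencil at `F x`
    have hτne : τ x ≠ 0 := by rw [hτ]; exact Complex.exp_ne_zero _
    obtain ⟨Du, hDu⟩ := rft_exists_GL_eq_diagonal _ (hDne (τ x) hτne)
    have hDuD : (Du : Matrix (Fin m) (Fin m) ℂ) = D (τ x) := by rw [hDu, hD]
    have hpencilF : (F x).1.map C + ∑ v, (X v : MvPolynomial (Fin n × Fin n) ℂ) • ((F x).2 v).map C =
        (D (τ x)).map C * Matrix.linSubstEntries γ M := by
      rw [hM, rft_linSubstEntries_pencil hγ, rft_map_C_mul_pencil, hF]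
      simp only [Matrix.mul_smul]
    have hchar : linSubst (Fin n × Fin n) ℂ (γ : Matrix (Fin n × Fin n) (Fin n × Fin n) ℂ)
        (perPoly (Fin n) ℂ) = C ((∏ k, Complex.exp (x.1 k)) * ∏ l, Complex.exp (x.2 l)) *
          perPoly (Fin n) ℂ := by
      have hγ' : (γ : Matrix (Fin n × Fin n) (Fin n × Fin n) ℂ) =
          Matrix.diagonal (fun k => Complex.exp (x.1 k)) ⊗ₖ Matrix.diagonal (fun l => Complex.exp (x.2 l)) := by
        rw [hγ, Matrix.diagonal_kronecker_diagonal, htor]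
        simp only [Complex.exp_add]
      rw [hγ']
      exact LRPencil.linSubst_diagonal_perPoly _ _
    have hdetF : ((F x).1.map C + ∑ v, (X v : MvPolynomial (Fin n × Fin n) ℂ) • ((F x).2 v).map C).det =
        perPoly (Fin n) ℂ := by
      rw [hpencilF, Matrix.det_mul, det_map_C, det_linSubstEntries, hDdet, hdet, hchar, ← mul_assoc,
        ← map_mul]
      have : τ x * ((∏ k, Complex.exp (x.1 k)) * ∏ l, Complex.exp (x.2 l)) = 1 := by
        rw [hτ, ← Complex.exp_sum, ← Complex.exp_sum, ← Complex.exp_add, ← Complex.exp_add,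
          neg_add_cancel, Complex.exp_zero]
      rw [this, C_1, one_mul]
    obtain ⟨g, h, h1, h2⟩ := hU (F x) hx hdetF
    rw [hF] at h1 h2
    simp only at h1 h2
    rw [hLift]
    rw [← hDuD] at h1 h2
    exact rft_lift_of_gauge hγ Λ A Du g h h1 h2
  -- (S3) hence every parameter is liftable
  have hP_all : ∀ x, P x := by
    intro x
    have ht : Tendsto (fun N : ℕ => ((N : ℂ))⁻¹ • x) atTop (𝓝 0) := by
      have h := (tendsto_inv_atTop_nhds_zero_nat (𝕜 := ℂ)).smul_const x
      rwa [zero_smul] at h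
    obtain ⟨N, hN, hN1⟩ := ((ht.eventually_mem hP_nhds).and (eventually_ge_atTop 1)).exists
    simp only [Set.mem_setOf_eq] at hN
    have hiter : ∀ k : ℕ, 1 ≤ k → P ((k : ℂ) • ((N : ℂ)⁻¹ • x)) := by
      intro k hk
      induction k, hk using Nat.le_induction with
      | base => simpa using hN
      | succ k _ ih =>
        have : ((k + 1 : ℕ) : ℂ) • ((N : ℂ)⁻¹ • x) = (k : ℂ) • ((N : ℂ)⁻¹ • x) + (N : ℂ)⁻¹ • x := by
          rw [Nat.cast_succ, add_smul, one_smul]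
        rw [this]
        exact hP_add _ _ ih hN
    have hx : x = (N : ℂ) • ((N : ℂ)⁻¹ • x) := by
      rw [smul_smul, mul_inv_cancel₀ (by exact_mod_cast (by omega : N ≠ 0)), one_smul]
    rw [hx]
    exact hiter N hN1
  -- conclusion by closure induction
  intro γ hγ
  have key : Lift γ := by
    refine Subgroup.closure_induction (p := fun γ _ => Lift γ) ?_ ?_ ?_ ?_ hγ
    · rintro γ ⟨d, e, hde⟩
      have hn1 : 1 ≤ n := by omega
      have hdet_ne : (γ : Matrix (Fin n × Fin n) (Fin n × Fin n) ℂ).det ≠ 0 :=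
        ((Matrix.isUnit_iff_isUnit_det _).1 (Units.isUnit γ)).ne_zero
      rw [hde, Matrix.det_diagonal] at hdet_ne
      have hd : ∀ k, d k ≠ 0 := by
        intro k hk
        refine hdet_ne (Finset.prod_eq_zero (Finset.mem_univ (k, (⟨0, by omega⟩ : Fin n))) ?_)
        simp [hk]
      have he : ∀ l, e l ≠ 0 := by
        intro l hl
        refine hdet_ne (Finset.prod_eq_zero (Finset.mem_univ ((⟨0, by omega⟩ : Fin n), l)) ?_)
        simp [hl]
      have hPx := hP_all (fun k => Complex.log (d k), fun l => Complex.log (e l))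
      rw [hP] at hPx
      refine hPx γ ?_
      rw [hde, htor]
      congr 1; funext p
      simp only [Complex.exp_add, Complex.exp_log (hd _), Complex.exp_log (he _)]
    · rw [hLift]
      exact ⟨1, 1, by simp [Matrix.map_one C C_0 C_1]⟩
    · intro γ δ _ _ hγ hδ
      rw [hLift] at hγ hδ ⊢
      exact rft_lift_mul hγ hδ
    · intro γ _ hγ
      rw [hLift] at hγ ⊢
      exact rft_lift_inv hγ
  rw [hLift] at key
  exact key

end Summit.ValiantsHypothesis.ValiantsHypothesis.Theorems

end
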